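import Literature.IUT.HodgeTheaters.GenuineFKitMergeInputsLiftsAllTransporters
import Literature.IUT.HodgeTheaters.Cor53iiAtGoodPlaceOfBaseIso
import HarnessLib

/-!
# [IUTchI] Cor 5.3 (ii) AT THE GENUINE GOOD SLOT OF THE MERGE TERM: the MODEL CASE «`α ↦ toD(α)` bijective» assembled BY NAME
# (L5 row R70 «COR53II-SLOT-ASSEMBLY@GOOD»; absorbs R51 «RIGIDOVERBASE-REEXPORT»)

S. Mochizuki, *Inter-universal Teichmüller theory I*, kurims manuscript (May 2020), §5 Corollary 5.3 (ii) p. 144 l. 12–15 («For `i = 1, 2`, let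
`ⁱ𝔉` be an `ℱ`-prime-strip; `ⁱ𝔇` the `𝒟`-prime-strip associated to `ⁱ𝔉` [cf. Remark 5.2.1, (i)]. Then the natural map `Isom(¹𝔉, ²𝔉) → Isom(¹𝔇, ²𝔇)`
[cf. Remark 5.2.1, (i)] is bijective»), proof p. 144 l. 33–36 («Assertion (ii) … follows immediately from [AbsTopIII], Proposition 3.2, (iv);
[AbsTopIII], Proposition 4.2, (i)») ([IUTchI] Cor 5.3 (ii) p.144) [claim: Mochizuki2012, status: disputed] (D-0012 claim key; PROOF-ONLY over landed
files; nothing of the series is asserted; no side is taken on [IUTchIII] Cor. 3.12).  [FrdII] Ex 1.1 (ii) p. 8, Ex 1.3 (ii) p. 11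
[cite: MochizukiFrdII2008, Ex 1.3 (ii) p.11]; [FrdI] Cor 5.4 p. 104 [cite: MochizukiFrdI2008, Cor. 5.4 p.104]; [AbsAnab] Thm 1.1.1 (ii), Lem 1.3.1,
Prop 1.2.1 (iii)/(vii) [cite: MochizukiAbsAnab2004, Prop 1.2.1 (iii) p.10].

## What this file proves (cell abc-iut; the (S1) slot of record ★ p498387 `goodLiftAt_model_case_iff : bijective ↔ LiftsAll ∧ RigidOverBase`)

Both conjuncts of the model case are now in the tree BY NAME, and this file knits them at the genuine good nonarchimedean slot:
* `LiftsAll` — abc-iut-w4-d047 ★ p510109 `liftsAll_goodStructureFunctorAt` (anabelian units transport, [AbsTopIII] Prop 3.2 (iv)), read through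
  ★ p510109 `goodLiftAt_model_case_iff_rigidOverBase : model case ↔ RigidOverBase (frobeniusGoodAt …).toBase`;
* `RigidOverBase` — the J-C53-BASE-ISO junction BY NAME: abc-iut-L1-t7 ★ p511168 `Cor53.perf_galoisBaseV_ofComplete_hker` (J3 knit = J1 ★ p510148
  `GaloisValDatum.exists_isOpenHom_galoisBaseV_iso_genuine` — the real carrier base `Π_v̲/U ↦ k̄^{aug U}` IS a genuine [FrdII] §2 base up to
  isomorphism — ∘ J2 abc-iut-L1-t4 ★ p509637 `PadicFrd.Datum.perf_hker_of_baseIso_genuine` ∘ abc-iut-L1-t7 ★ p504140 `hker_genuine`: every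
  self-equivalence of the perfection Frobenioid over `𝟭_{ℬ(Π)⁰}` is `≅ 𝟭`, NO law `hO`), whose inputs at `Π_v̲ = Π_{X̲→_K} ×_{G_F} Gal(k̄/k)` are:
  tempered (★ p511168 `Cor53.isTempered_PiLoc_PiXarrow`: PROFINITE), temp-slim ⟸ `Δ_C` slim (abc-iut-L5-t2 `isSlimGroup_PiLoc_PiXarrow_of_geom_slim`,
  [AbsAnab] Thm 1.1.1 (ii) for `G_v̲` being a tree theorem), `ℬ(Π_v̲)⁰` slim (`isSlim_cosetCat_of_isSlimGroup`), second countable (a BINDER).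
Declarations (generic place data `p k ι hX`, then racer C's `frobeniusGoodAt CG hA B I x hx`):
* §1 `rigidOverBase_goodLocalFrobenioidOfEmb_of_geom_slim` — `RigidOverBase (D.goodLocalFrobenioidOfEmb p k ι hX).toBase` modulo
  {`IsSlimGroup D.DeltaC` = frozen FACT F-0004 (1), `[SecondCountableTopology Π_v̲]`}; `…_of_geomAndArithSlim` (F-0004 BY NAME); `…_of_facts` — the
  Galois-countability traded for the frozen FACT (E2) `Rmk253.TameGaloisCountable` (F-1979) via ★ p512024 `secondCountableTopology_PiLoc_PiXarrow_of_tameGaloisCountable`.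
* §2 AT THE MERGE TERM: `rigidOverBase_frobeniusGoodAt_of_geom_slim` / `_of_facts`; **`goodLiftAt_model_case_of_geom_slim`** / **`…_of_geomAndArithSlim`** /
  **`…_of_facts`** — the Cor 5.3 (ii) MODEL CASE at the (S1) slot of record («`α ↦ toD(α)` is bijective on the automorphisms of the reference object of the
  genuine `𝒞_v̲`») modulo ONLY the frozen FACTS {F-1979 (E2), F-0004} in the `_of_facts` form (LAW ∅ · side ∅; no `hO`, no `hker`/`hlift` binder: both
  halves are theorems).
BINDER CENSUS (`_of_facts` forms): kit binders {CG, hS, M, hA, hI, B, ΛBad} ∪ {I, x, hx, hxb} · FACT {F-1979 `Rmk253.TameGaloisCountable D.geom.extF`,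
F-0004 `GeomAndArithSlim D.geom.extF`} · LAW 0 · side 0 · def 0 · instance 0 · notation 0 · no new `Prop` fact.
RESIDUAL (honest): the KIT-level statement `FKit.IsomFtoDBijective` of Cor 5.3 (ii) needs the model case at EVERY index — the archimedean slot
(★ p499353, discharged at `ArchFSlot`) and the bad slot (★ p499791, a statement about the merge INPUT `I.m1`) are NOT conjoined here; Cor 5.3 (ii) is
NOT claimed.  typed ≠ proved beyond what is here; nothing asserts abc proved or refuted.
-/

noncomputable section

namespace Literature.IUT.HodgeTheaters

open CategoryTheory Opposite Literature.AnabelianGeometry.SemiGraphs Literature.AlgebraicGeometry.Frobenioids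
open Literature.AnabelianGeometry.AbsoluteAnabelian

namespace InitialThetaData

/-! ### §1. `RigidOverBase` at the genuine place, from the J-C53-BASE-ISO junction -/

section PlaceData

universe uF vK

variable {F K Fbar : Type} [Field F] [NumberField F] [Field K] [NumberField K] [Algebra F K]
  [Field Fbar] [Algebra F Fbar] [Algebra K Fbar]
  {E : WeierstrassCurve F} [E.IsElliptic] {l : ℕ} {Pb : BadPlacePredicates K}
  (D : InitialThetaData F K Fbar E l Pb)
  (p : ℕ) [Fact p.Prime] (k : Type) [NontriviallyNormedField k] [CompleteSpace k] [IsUltrametricDist k]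
  [NormedAlgebra ℚ_[p] k] [FiniteDimensional ℚ_[p] k] [Algebra K k] (ι : Fbar →ₐ[K] AlgebraicClosure k)
  [IsScalarTower F K Fbar] [Normal K Fbar] (hX : IsOpen (D.PiXarrow : Set D.PiC))

include hX in
/-- **`RigidOverBase` AT THE GENUINE GOOD PLACE** (`𝒞_v̲ := (D.goodLocalFrobenioidOfEmb p k ι hX).Cv` over `𝒟_v̲ = ℬ(Π_v̲)⁰`): every self-equivalence of
the genuine `𝒞_v̲` lying under the identity of `𝒟_v̲` through `toBase` is `≅ 𝟭` — the injectivity half of the Cor 5.3 (ii) model case — modulo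
{`IsSlimGroup D.DeltaC` (F-0004 (1)), `[SecondCountableTopology Π_v̲]`}: abc-iut-L1-t7 ★ p511168 `Cor53.perf_galoisBaseV_ofComplete_hker` (the
J-C53-BASE-ISO junction J1 ∘ J2 ∘ `hker_genuine`, NO law) BY NAME at `Π_v̲ := Π_{X̲→_K} ×_{G_F} Gal(k̄/k)`, which is profinite hence tempered
(★ p511168 `Cor53.isTempered_PiLoc_PiXarrow`), temp-slim once `Δ_C` is, with slim `ℬ(Π_v̲)⁰` — i.e. the `RigidOverBase`-form RE-EXPORT (R51) of
★ p511168 §3's `descend`-injectivity. ([IUTchI] Cor 5.3 (ii) p.144) [claim: Mochizuki2012, status: disputed] -/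
theorem rigidOverBase_goodLocalFrobenioidOfEmb_of_geom_slim [SecondCountableTopology (D.PiLoc D.PiXarrow (localToGF F k ι))]
    (hΔ : IsSlimGroup D.DeltaC) :
    letI := GaloisValDatum.normVal k
    CatIsomorphism.RigidOverBase (D.goodLocalFrobenioidOfEmb p k ι hX).toBase := by
  letI := GaloisValDatum.normVal k
  haveI := Literature.IUT.HodgeTheaters.compactSpace_gal_algebraicClosure p k
  haveI : CompactSpace (D.PiLoc D.PiXarrow (localToGF F k ι)) :=
    D.compactSpace_PiLoc D.PiXarrow (localToGF F k ι) hX (continuous_localToGF F k ι)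
  have hZ : IsSlimGroup (D.PiLoc D.PiXarrow (localToGF F k ι)) := D.isSlimGroup_PiLoc_PiXarrow_of_geom_slim p k hΔ ι hX
  intro Ψ hΨ
  exact Cor53.perf_galoisBaseV_ofComplete_hker p k (Cor53.isTempered_PiLoc_PiXarrow D p k ι hX) hZ
    (D.augLoc D.PiXarrow (localToGF F k ι)) (D.continuous_augLoc D.PiXarrow (localToGF F k ι))
    (D.isOpenMap_augLoc D.PiXarrow (localToGF F k ι) hX (continuous_localToGF F k ι))
    (PadicFrd.isSlim_cosetCat_of_isSlimGroup hZ) Ψ hΨ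

include hX in
/-- **F-0004 BY NAME**: the same consuming the frozen fact `GeomAndArithSlim D.geom.extF` ([AbsAnab] Lem. 1.3.1 «`Δ`, `Π` slim»; first conjunct).
([IUTchI] Cor 5.3 (ii) p.144) [claim: Mochizuki2012, status: disputed] -/
theorem rigidOverBase_goodLocalFrobenioidOfEmb_of_geomAndArithSlim [SecondCountableTopology (D.PiLoc D.PiXarrow (localToGF F k ι))]
    (h : Literature.AnabelianGeometry.AbsoluteAnabelian.FundamentalExtension.GeomAndArithSlim D.geom.extF) :
    letI := GaloisValDatum.normVal k
    CatIsomorphism.RigidOverBase (D.goodLocalFrobenioidOfEmb p k ι hX).toBase :=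
  D.rigidOverBase_goodLocalFrobenioidOfEmb_of_geom_slim p k ι hX h.1

include hX in
/-- **FROZEN FACTS ONLY**: `RigidOverBase` at the genuine good place modulo (E2) `Rmk253.TameGaloisCountable D.geom.extF` (F-1979: Galois-countability
of `Π_{C_F}`, whence of `Π_v̲` — abc-iut-L1-t7 ★ p512024 `secondCountableTopology_PiLoc_PiXarrow_of_tameGaloisCountable`) and `GeomAndArithSlim D.geom.extF`
(F-0004, first conjunct) — LAW ∅ · side ∅ (the `RigidOverBase`-form twin of ★ p512024 `Cor53.goodLocalFrobenioidOfEmb_descend_injective_of_facts`).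
([IUTchI] Cor 5.3 (ii) p.144) [claim: Mochizuki2012, status: disputed] -/
theorem rigidOverBase_goodLocalFrobenioidOfEmb_of_facts (hE2 : Rmk253.TameGaloisCountable D.geom.extF)
    (h : Literature.AnabelianGeometry.AbsoluteAnabelian.FundamentalExtension.GeomAndArithSlim D.geom.extF) :
    letI := GaloisValDatum.normVal k
    CatIsomorphism.RigidOverBase (D.goodLocalFrobenioidOfEmb p k ι hX).toBase := by
  haveI := D.secondCountableTopology_PiLoc_PiXarrow_of_tameGaloisCountable p k ι hE2
  exact D.rigidOverBase_goodLocalFrobenioidOfEmb_of_geom_slim p k ι hX h.1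

end PlaceData

/-! ### §2. AT THE MERGE TERM: the Cor 5.3 (ii) model case at the (S1) slot of record -/

section AtTerm

variable {F K Fbar : Type} [Field F] [NumberField F] [Field K] [NumberField K] [Algebra F K]
  [Field Fbar] [Algebra F Fbar] [Algebra K Fbar]
  {E : WeierstrassCurve F} [E.IsElliptic] {l : ℕ} {Pb : BadPlacePredicates K}
  (D : InitialThetaData F K Fbar E l Pb) (CG : D.geom.pe.CuspGalois) (hS : D.CuspClassesNormaliserStable) [Fact l.Prime]
  (M : D.TorsionMonodromy) (hA : D.geom.pe.ArrowCoveringClaims)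
  (hI : ∀ k ∈ D.geom.pe.inertia D.geom.pe.ε1, M.tau (D.geom.embK k) = 0)
  (B : ∀ v, v ∈ D.indexCopyBad → D.BadPairAt v) (ΛBad : ∀ v (h : v ∈ D.indexCopyBad), D.LocalArrowLaw CG hS (B v h).H)
  (I : D.MergeInputs B) (x : D.IndexCopy) (hx : x ∉ D.indexCopyArc) (hxb : x ∉ D.indexCopyBad) [Fact (D.primeAt x hx).Prime]

omit [Fact l.Prime] in
include I in
/-- **`RigidOverBase` AT THE MERGE TERM's GOOD SLOT** (racer C's `frobeniusGoodAt CG hA B I x hx`, the place data of record `p_v̲ = primeAt x`,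
`K_v̲ = KvAt x`, `ι = localEmb`, openness of `Π_{X̲→_K}` from the merge inputs): modulo {F-0004 (1), `[SecondCountableTopology Π_v̲]`}.
([IUTchI] Cor 5.3 (ii) p.144) [claim: Mochizuki2012, status: disputed] -/
theorem rigidOverBase_frobeniusGoodAt_of_geom_slim
    [haveI := D.isScalarTower
     haveI := D.normal_K
     letI := D.algebraKvAt x hx
     SecondCountableTopology (D.PiLoc D.PiXarrow (localToGF F (D.KvAt x hx)
       (localEmb (K := K) (Fbar := Fbar) (AlgebraicClosure (D.KvAt x hx)))))]
    (hΔ : IsSlimGroup D.DeltaC) :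
    letI := GaloisValDatum.normVal (D.KvAt x hx)
    CatIsomorphism.RigidOverBase (D.frobeniusGoodAt CG hA B I x hx).toBase := by
  haveI := D.isScalarTower
  haveI := D.normal_K
  letI := D.algebraKvAt x hx
  haveI := GaloisValDatum.finiteDimensional_rescaledCompletion K (D.primeAt x hx) (D.specAt x hx) (D.primeAt_mem x hx)
  exact D.rigidOverBase_goodLocalFrobenioidOfEmb_of_geom_slim (D.primeAt x hx) (D.KvAt x hx)
    (localEmb (K := K) (Fbar := Fbar) (AlgebraicClosure (D.KvAt x hx))) (D.isOpen_PiXarrow_of_mergeInputs CG hA B I) hΔ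

include hxb in
/-- **[IUTchI] Cor 5.3 (ii), MODEL CASE AT THE GENUINE GOOD SLOT — ASSEMBLED.**  At every good nonarchimedean index `x` of the merge term, the
natural map «`α ↦ toD(α)`» on the automorphisms of the reference object of the (S1) slot of record (`goodLiftToDAt`, ★ p498387) IS BIJECTIVE, modulo
{F-0004 (1) `IsSlimGroup D.DeltaC`, `[SecondCountableTopology Π_v̲]`} — surjectivity = abc-iut-w4-d047 ★ p510109 `liftsAll_goodStructureFunctorAt`
([AbsTopIII] Prop 3.2 (iv) via the anabelian units transport), injectivity = §1 (the [FrdI]/[FrdII] rigidity chain `hker_genuine` through the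
J-C53-BASE-ISO junction), knit by ★ p510109 `goodLiftAt_model_case_iff_rigidOverBase`.  No LAW, no `hker`/`hlift` binder.
([IUTchI] Cor 5.3 (ii) p.144) [claim: Mochizuki2012, status: disputed] -/
theorem goodLiftAt_model_case_of_geom_slim
    [haveI := D.isScalarTower
     haveI := D.normal_K
     letI := D.algebraKvAt x hx
     SecondCountableTopology (D.PiLoc D.PiXarrow (localToGF F (D.KvAt x hx)
       (localEmb (K := K) (Fbar := Fbar) (AlgebraicClosure (D.KvAt x hx)))))]
    (hΔ : IsSlimGroup D.DeltaC) :
    letI := GaloisValDatum.normVal (D.KvAt x hx)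
    Function.Bijective (fun α : SingleObj.star _ ≅ SingleObj.star _ =>
        (show (D.baseKitThetaNFOfBadPairs CG hS M hA hI B ΛBad).model x ≅ (D.baseKitThetaNFOfBadPairs CG hS M hA hI B ΛBad).model x from
          (D.goodLiftToDAt CG hS M hA hI B ΛBad I x hx hxb).mapIso α)) :=
  (D.goodLiftAt_model_case_iff_rigidOverBase CG hS M hA hI B ΛBad x I hx hxb).mpr
    (D.rigidOverBase_frobeniusGoodAt_of_geom_slim CG hA B I x hx hΔ)

include hxb in
/-- **F-0004 BY NAME**: the model case at the genuine good slot consuming the frozen fact `GeomAndArithSlim D.geom.extF` ([AbsAnab] Lem. 1.3.1).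
Binder census: FACT {F-0004} · instance binder {`SecondCountableTopology Π_v̲`} · kit binders ∪ {I, x, hx, hxb}.
([IUTchI] Cor 5.3 (ii) p.144) [claim: Mochizuki2012, status: disputed] -/
theorem goodLiftAt_model_case_of_geomAndArithSlim
    [haveI := D.isScalarTower
     haveI := D.normal_K
     letI := D.algebraKvAt x hx
     SecondCountableTopology (D.PiLoc D.PiXarrow (localToGF F (D.KvAt x hx)
       (localEmb (K := K) (Fbar := Fbar) (AlgebraicClosure (D.KvAt x hx)))))]
    (h : Literature.AnabelianGeometry.AbsoluteAnabelian.FundamentalExtension.GeomAndArithSlim D.geom.extF) :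
    letI := GaloisValDatum.normVal (D.KvAt x hx)
    Function.Bijective (fun α : SingleObj.star _ ≅ SingleObj.star _ =>
        (show (D.baseKitThetaNFOfBadPairs CG hS M hA hI B ΛBad).model x ≅ (D.baseKitThetaNFOfBadPairs CG hS M hA hI B ΛBad).model x from
          (D.goodLiftToDAt CG hS M hA hI B ΛBad I x hx hxb).mapIso α)) :=
  D.goodLiftAt_model_case_of_geom_slim CG hS M hA hI B ΛBad I x hx hxb h.1

omit [Fact l.Prime] in
include I in
/-- **FROZEN FACTS ONLY, at the merge term's good slot**: `RigidOverBase (frobeniusGoodAt …).toBase` modulo {F-1979 (E2), F-0004} — LAW ∅ · side ∅.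
([IUTchI] Cor 5.3 (ii) p.144) [claim: Mochizuki2012, status: disputed] -/
theorem rigidOverBase_frobeniusGoodAt_of_facts (hE2 : Rmk253.TameGaloisCountable D.geom.extF)
    (h : Literature.AnabelianGeometry.AbsoluteAnabelian.FundamentalExtension.GeomAndArithSlim D.geom.extF) :
    letI := GaloisValDatum.normVal (D.KvAt x hx)
    CatIsomorphism.RigidOverBase (D.frobeniusGoodAt CG hA B I x hx).toBase := by
  haveI := D.isScalarTower
  haveI := D.normal_K
  letI := D.algebraKvAt x hx
  haveI := GaloisValDatum.finiteDimensional_rescaledCompletion K (D.primeAt x hx) (D.specAt x hx) (D.primeAt_mem x hx)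
  exact D.rigidOverBase_goodLocalFrobenioidOfEmb_of_facts (D.primeAt x hx) (D.KvAt x hx)
    (localEmb (K := K) (Fbar := Fbar) (AlgebraicClosure (D.KvAt x hx))) (D.isOpen_PiXarrow_of_mergeInputs CG hA B I) hE2 h

include hxb in
/-- **[IUTchI] Cor 5.3 (ii), MODEL CASE AT THE GENUINE GOOD SLOT — FROZEN FACTS ONLY (the census of record).**  At every good nonarchimedean index
`x` of the merge term, «`α ↦ toD(α)`» on the automorphisms of the reference object of the (S1) slot of record is BIJECTIVE modulo ONLY the frozen
FACTS (E2) `Rmk253.TameGaloisCountable D.geom.extF` (F-1979) and `GeomAndArithSlim D.geom.extF` (F-0004): injective ⟸ §1 `_of_facts` (rigidity chain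
`hker_genuine` through the J-C53-BASE-ISO junction, abc-iut-L1-t7 ★ p511168/p512024), surjective ⟸ abc-iut-w4-d047 ★ p510109 `liftsAll_goodStructureFunctorAt`
(anabelian units transport), knit by ★ p510109 `goodLiftAt_model_case_iff_rigidOverBase`.  Binder census: kit binders ∪ {I, x, hx, hxb} · FACT {F-1979, F-0004} ·
LAW ∅ · side ∅ · hker/hlift/hO 0. ([IUTchI] Cor 5.3 (ii) p.144) [claim: Mochizuki2012, status: disputed] -/
theorem goodLiftAt_model_case_of_facts (hE2 : Rmk253.TameGaloisCountable D.geom.extF)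
    (h : Literature.AnabelianGeometry.AbsoluteAnabelian.FundamentalExtension.GeomAndArithSlim D.geom.extF) :
    letI := GaloisValDatum.normVal (D.KvAt x hx)
    Function.Bijective (fun α : SingleObj.star _ ≅ SingleObj.star _ =>
        (show (D.baseKitThetaNFOfBadPairs CG hS M hA hI B ΛBad).model x ≅ (D.baseKitThetaNFOfBadPairs CG hS M hA hI B ΛBad).model x from
          (D.goodLiftToDAt CG hS M hA hI B ΛBad I x hx hxb).mapIso α)) :=
  (D.goodLiftAt_model_case_iff_rigidOverBase CG hS M hA hI B ΛBad x I hx hxb).mpr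
    (D.rigidOverBase_frobeniusGoodAt_of_facts CG hA B I x hx hE2 h)

end AtTerm

end InitialThetaData

end Literature.IUT.HodgeTheaters

end
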